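import Literature.Probability.Distributions.IndepProductLawDistance
import HarnessLib

/-!
# The first success of a block of independent trials: its law, and blocks of blocks

Topic `Probability/Distributions`; theorems-only companion of `IndepProductLaw.lean`. A *trial* is a
draw from a law `p` on `Option α` (`none` = failure/abort, `some a` = success with value `a`); a
*block* is `k` independent trials, read through its FIRST success
`v ↦ (List.ofFn v).findSome? id ∈ Option α`. This is the "repeat the randomized procedure until it
succeeds (at most `k` times) and keep the first output" step of many reductions — e.g. the procedure
`W` of Micciancio–Regev 2007, Thm. 5.23 (p. 29: "repeat … and let `w₁, …, w_N` be the first `N`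
successful outputs"), in the blockwise form a bit-level machine naturally implements (block `i`
supplies `wᵢ`), and the amplification of a verifiable solver (Cor. 5.13 via Lemma 5.10: call the
`IncGDD` solver until a verified solution appears).

* `findSome?_ofFn_cons` — the recursion `first(x :: v) = x.or (first v)`;
* `indepLaw_succ_map_findSome` — hence `law(first of k+1 trials) = p ≫= (x ↦ law(first of k).map (x.or ·))`;
* `indepLaw_map_findSome_apply_none` / `_some` — **the law of the first success**:
  `Pr[none] = p(none)^k`, `Pr[some a] = p(some a) · ∑_{t<k} p(none)^t`;
* `one_sub_mul_sum_pow` — the geometric identity `(1 − ρ) ∑_{t<k} ρ^t = 1 − ρ^k` in `ℝ≥0∞`, so that,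
  for the CONDITIONAL law `q` of a success (`p(some a) = (1 − p none) · q a`, which exists whenever
  `p none ≠ 1`: `exists_cond_law`), `Pr[some a] = (1 − p(none)^k) · q a`
  (`indepLaw_map_findSome_apply_some_eq`);
* `toReal_indepLaw_exists_eq_none_le` — **`N` blocks** (marginals as in
  `LWE.indepLaw_toOuterMeasure_apply_preimage`): `Pr[some block has no success] ≤ N · p(none)^k`;
* `indepLaw_firstSuccess_apply_comp_some`, `toOuterMeasure_indepLaw_firstSuccess_inter_le` — on the
  all-success part, the `N` first successes are iid with law `q` up to the factor `(1 − p(none)^k)^N ≤ 1`: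
  `Pr[all blocks succeed ∧ values ∈ E] ≤ q^{⊗N}(E)` — bad events of the idealised iid experiment
  transfer to the real one at no cost.

## References

* W. Feller, *An Introduction to Probability Theory and Its Applications I*, 3rd ed., Wiley 1968,
  Ch. VI §§1–2 (Bernoulli trials, waiting for the first success; the geometric law) [folklore].
* D. Micciancio, O. Regev, *Worst-case to average-case reductions based on Gaussian measures*,
  SIAM J. Comput. 37 (2007) 267–302, proof of Thm. 5.23 (p. 29–30: the repetition of `W` and "with
  probability exponentially close to 1 we will have at least `N` vectors") — the consumer.
-/

noncomputable section

open scoped ENNReal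

namespace Literature.Probability.Distributions

open PMF Finset MeasureTheory

variable {α : Type*}

/-! ### The first success of one block -/

/-- The recursion of the first success along `Fin.cons`: `first(x :: v) = x.or (first v)`. [folklore] -/
theorem findSome?_ofFn_cons (x : Option α) {k : ℕ} (v : Fin k → Option α) :
    (List.ofFn (Fin.cons x v : Fin (k + 1) → Option α)).findSome? id =
      x.or ((List.ofFn v).findSome? id) := by
  rw [List.ofFn_succ, List.findSome?_cons]
  simp only [Fin.cons_zero, Fin.cons_succ, id]
  cases x <;> rfl

/-- Post-composition of a law on `Option α` with `y ↦ x.or y`: the Dirac mass at `x` if `x` is a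
success, the law itself if `x` is a failure. [folklore] -/
theorem map_or_eq (G : PMF (Option α)) (x : Option α) :
    (G.map fun y => x.or y) = x.elim G fun b => PMF.pure (some b) := by
  cases x with
  | none => exact PMF.map_id G
  | some b => exact PMF.map_const _ _

/-- One more trial in front: `law(first of k+1 trials) = p ≫= (x ↦ law(first of k trials).map (x.or ·))`.
[folklore] -/
theorem indepLaw_succ_map_findSome (p : PMF (Option α)) (k : ℕ) :
    ((indepLaw (k + 1) fun _ => p).map fun v => (List.ofFn v).findSome? id) =
      p.bind fun x => ((indepLaw k fun _ => p).map fun v => (List.ofFn v).findSome? id).map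
        fun y => x.or y := by
  rw [indepLaw_succ, PMF.map_bind]
  refine congrArg p.bind (funext fun x => ?_)
  rw [PMF.map_comp, PMF.map_comp]
  exact congrArg (PMF.map · _) (funext fun v => findSome?_ofFn_cons x v)

/-- **Law of the first success, failure mass**: `Pr[no success among k trials] = p(none)^k`. [folklore] -/
theorem indepLaw_map_findSome_apply_none (p : PMF (Option α)) : ∀ k : ℕ,
    ((indepLaw k fun _ => p).map fun v => (List.ofFn v).findSome? id) none = p none ^ k
  | 0 => by
    rw [pow_zero, indepLaw_zero, PMF.pure_map, PMF.pure_apply, if_pos]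
    rfl
  | k + 1 => by
    classical
    rw [indepLaw_succ_map_findSome, PMF.bind_apply, tsum_eq_single none, map_or_eq,
      Option.elim, indepLaw_map_findSome_apply_none p k, pow_succ, mul_comm]
    intro x hx
    obtain ⟨b, rfl⟩ := Option.ne_none_iff_exists'.1 hx
    rw [map_or_eq, Option.elim, PMF.pure_apply, if_neg (Option.some_ne_none b).symm, mul_zero]

/-- **Law of the first success, success masses**:
`Pr[first success = a] = p(some a) · ∑_{t<k} p(none)^t` (the success happens at trial `t + 1` after
`t` failures). [folklore] -/
theorem indepLaw_map_findSome_apply_some (p : PMF (Option α)) (a : α) : ∀ k : ℕ,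
    ((indepLaw k fun _ => p).map fun v => (List.ofFn v).findSome? id) (some a) =
      p (some a) * ∑ t ∈ Finset.range k, p none ^ t
  | 0 => by
    rw [Finset.range_zero, Finset.sum_empty, mul_zero, indepLaw_zero, PMF.pure_map,
      PMF.pure_apply, if_neg]
    exact fun h => Option.some_ne_none a (h.trans rfl)
  | k + 1 => by
    classical
    rw [indepLaw_succ_map_findSome, PMF.bind_apply, ENNReal.tsum_eq_add_tsum_ite (some a),
      tsum_eq_single none]
    · rw [if_neg (Option.some_ne_none a).symm, map_or_eq, map_or_eq, Option.elim, Option.elim,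
        PMF.pure_apply, if_pos rfl, mul_one, indepLaw_map_findSome_apply_some p a k,
        Finset.sum_range_succ', pow_zero, mul_add, mul_one, add_comm, Finset.mul_sum,
        Finset.mul_sum, Finset.mul_sum]
      congr 1
      refine Finset.sum_congr rfl fun t _ => ?_
      rw [pow_succ]
      ring
    · intro x hx
      obtain ⟨b, rfl⟩ := Option.ne_none_iff_exists'.1 hx
      split_ifs with hxa
      · rfl
      · rw [map_or_eq, Option.elim, PMF.pure_apply, if_neg (fun h => hxa h.symm), mul_zero]

/-- The geometric identity `(1 − ρ) · ∑_{t<k} ρ^t = 1 − ρ^k` in `ℝ≥0∞`, for `ρ ≤ 1`. [folklore] -/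
theorem one_sub_mul_sum_pow {ρ : ℝ≥0∞} (hρ : ρ ≤ 1) : ∀ k : ℕ,
    (1 - ρ) * ∑ t ∈ Finset.range k, ρ ^ t = 1 - ρ ^ k
  | 0 => by simp
  | k + 1 => by
    have hk : ρ ^ (k + 1) ≤ ρ ^ k := by
      rw [pow_succ]; exact mul_le_of_le_one_right zero_le hρ
    have hk1 : ρ ^ k ≤ 1 := pow_le_one₀ zero_le hρ
    have htop : ρ ^ k ≠ ∞ := ENNReal.pow_ne_top (ne_top_of_le_ne_top ENNReal.one_ne_top hρ)
    rw [Finset.sum_range_succ, mul_add, one_sub_mul_sum_pow hρ k, ENNReal.sub_mul fun _ _ => htop,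
      one_mul, ← pow_succ', tsub_add_tsub_cancel hk1 hk]

/-- **The conditional law of a success exists** whenever successes have positive probability:
some `q : PMF α` has `p(some a) = (1 − p none) · q a` for all `a`. [folklore] -/
theorem exists_cond_law (p : PMF (Option α)) (hp : p none ≠ 1) :
    ∃ q : PMF α, ∀ a, p (some a) = (1 - p none) * q a := by
  have hsum : ∑' a, p (some a) = 1 - p none := by
    have hsplit : p none + ∑' a, p (some a) = 1 := by
      have h1 : ∑' o, (({none} : Set (Option α)).indicator p o +
          ({none}ᶜ : Set (Option α)).indicator p o) = 1 := by
        rw [← p.tsum_coe]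
        exact tsum_congr fun o => Set.indicator_self_add_compl_apply _ _ _
      rw [ENNReal.tsum_add] at h1
      have h2 : ∑' o, ({none} : Set (Option α)).indicator p o = p none := by
        rw [← PMF.toOuterMeasure_apply, PMF.toOuterMeasure_apply_singleton]
      have h3 : ∑' o, ({none}ᶜ : Set (Option α)).indicator p o = ∑' a, p (some a) := by
        rw [← (Option.some_injective α).tsum_eq]
        · exact tsum_congr fun a => Set.indicator_of_mem (by simp) _
        · intro o ho
          have ho' : o ∈ ({none}ᶜ : Set (Option α)) := Set.mem_of_indicator_ne_zero ho
          obtain ⟨a, rfl⟩ := Option.ne_none_iff_exists'.1 (by simpa using ho')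
          exact ⟨a, rfl⟩
      rwa [h2, h3] at h1
    exact (ENNReal.sub_eq_of_eq_add (p.apply_ne_top none)
      (hsplit.symm.trans (add_comm _ _))).symm
  have h0 : ∑' a, p (some a) ≠ 0 := by
    rw [hsum]
    exact (tsub_pos_of_lt (lt_of_le_of_ne (p.coe_le_one none) hp)).ne'
  have htop : ∑' a, p (some a) ≠ ∞ := by
    rw [hsum]; exact ne_top_of_le_ne_top ENNReal.one_ne_top tsub_le_self
  refine ⟨PMF.normalize (fun a => p (some a)) h0 htop, fun a => ?_⟩
  rw [PMF.normalize_apply, hsum, mul_comm (1 - p none), mul_assoc,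
    ENNReal.inv_mul_cancel (hsum ▸ h0) (hsum ▸ htop), mul_one]

/-- **Law of the first success through the conditional law**: if `p(some a) = (1 − p none) q a` then
`Pr[first success = a] = (1 − p(none)^k) · q a` — given that the block succeeds, its first success has
law `q`. [folklore] -/
theorem indepLaw_map_findSome_apply_some_eq (p : PMF (Option α)) {q : PMF α}
    (hq : ∀ a, p (some a) = (1 - p none) * q a) (a : α) (k : ℕ) :
    ((indepLaw k fun _ => p).map fun v => (List.ofFn v).findSome? id) (some a) =
      (1 - p none ^ k) * q a := by
  rw [indepLaw_map_findSome_apply_some, hq, mul_comm (1 - p none), mul_assoc,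
    one_sub_mul_sum_pow (p.coe_le_one none), mul_comm]

/-! ### `N` independent blocks -/

/-- **Union bound over `N` blocks**: the probability that SOME block of `k` trials has no success is
at most `N · p(none)^k`. [folklore] -/
theorem toReal_indepLaw_exists_eq_none_le (p : PMF (Option α)) (N k : ℕ) :
    ((indepLaw N fun _ => (indepLaw k fun _ => p).map fun v => (List.ofFn v).findSome? id).toOuterMeasure
        {o | ∃ j, o j = none}).toReal ≤ N * (p none ^ k).toReal := by
  -- marginals of a product (cf. `LWE.indepLaw_toOuterMeasure_apply_preimage`, not imported here)
  have hmarg : ∀ (r : PMF (Option α)) (j : Fin N),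
      (indepLaw N fun _ => r).toOuterMeasure {o | o j ∈ ({none} : Set (Option α))} =
        r.toOuterMeasure {none} := by
    intro r j
    classical
    have hset : {o : Fin N → Option α | o j ∈ ({none} : Set (Option α))} =
        {o | ∀ i, o i ∈ (if i = j then ({none} : Set (Option α)) else Set.univ)} := by
      ext o
      simp only [Set.mem_setOf_eq]
      refine ⟨fun h i => ?_, fun h => by simpa using h j⟩
      split_ifs with hi
      · subst hi; exact h
      · exact Set.mem_univ _
    rw [hset, toOuterMeasure_indepLaw_pi, Finset.prod_eq_single j]
    · rw [if_pos rfl]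
    · intro i _ hi
      rw [if_neg hi]
      exact (r.toOuterMeasure_apply_eq_one_iff _).2 fun _ _ => Set.mem_univ _
    · exact fun h => (h (Finset.mem_univ j)).elim
  have hne : ∀ (r : PMF (Fin N → Option α)) (T : Set (Fin N → Option α)), r.toOuterMeasure T ≠ ∞ :=
    fun r T => ne_top_of_le_ne_top ENNReal.one_ne_top ((r.toOuterMeasure_mono (Set.subset_univ _)).trans_eq
      ((r.toOuterMeasure_apply_eq_one_iff _).2 (Set.subset_univ _)))
  have hU : {o : Fin N → Option α | ∃ j, o j = none} = ⋃ j, {o | o j ∈ ({none} : Set (Option α))} := by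
    ext o; simp
  rw [hU]
  refine (ENNReal.toReal_mono (ENNReal.sum_ne_top.2 fun j _ => hne _ _)
    (measure_iUnion_fintype_le _ _)).trans (le_of_eq ?_)
  rw [ENNReal.toReal_sum fun j _ => hne _ _]
  simp only [hmarg, PMF.toOuterMeasure_apply_singleton, indepLaw_map_findSome_apply_none,
    Finset.sum_const, Finset.card_univ, Fintype.card_fin, nsmul_eq_mul]

/-- **On the all-success part, the first successes are iid `q` up to a factor**: for tuples of
successes, `Pr[o = (some wⱼ)ⱼ] = (1 − p(none)^k)^N · q^{⊗N}(w)`. [folklore] -/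
theorem indepLaw_firstSuccess_apply_comp_some (p : PMF (Option α)) {q : PMF α}
    (hq : ∀ a, p (some a) = (1 - p none) * q a) (N k : ℕ) (w : Fin N → α) :
    (indepLaw N fun _ => (indepLaw k fun _ => p).map fun v => (List.ofFn v).findSome? id)
        (fun j => some (w j)) = (1 - p none ^ k) ^ N * indepLaw N (fun _ => q) w := by
  rw [indepLaw_apply, indepLaw_apply,
    show (1 - p none ^ k) ^ N = ∏ _j : Fin N, (1 - p none ^ k) by
      rw [Finset.prod_const, Finset.card_univ, Fintype.card_fin],
    ← Finset.prod_mul_distrib]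
  exact Finset.prod_congr rfl fun j _ => indepLaw_map_findSome_apply_some_eq p hq (w j) k

/-- **Bad events transfer from the idealised iid experiment at no cost**: for every event `S` on
tuples of outcomes, `Pr[all N blocks succeed ∧ o ∈ S] = (1 − p(none)^k)^N · q^{⊗N}({w | (some wⱼ)ⱼ ∈ S})
≤ q^{⊗N}({w | (some wⱼ)ⱼ ∈ S})`. [folklore] -/
theorem toOuterMeasure_indepLaw_firstSuccess_inter_eq (p : PMF (Option α)) {q : PMF α}
    (hq : ∀ a, p (some a) = (1 - p none) * q a) (N k : ℕ) (S : Set (Fin N → Option α)) :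
    (indepLaw N fun _ => (indepLaw k fun _ => p).map fun v => (List.ofFn v).findSome? id).toOuterMeasure
        (S ∩ {o | ∀ j, o j ≠ none}) =
      (1 - p none ^ k) ^ N *
        (indepLaw N fun _ => q).toOuterMeasure {w | (fun j => some (w j)) ∈ S} := by
  classical
  set P := indepLaw N fun _ => (indepLaw k fun _ => p).map fun v => (List.ofFn v).findSome? id with hP
  set g : (Fin N → α) → (Fin N → Option α) := fun w j => some (w j) with hg
  have hginj : Function.Injective g := fun w w' h => funext fun j => Option.some_injective _ (congrFun h j)
  rw [PMF.toOuterMeasure_apply, PMF.toOuterMeasure_apply, ← ENNReal.tsum_mul_left]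
  -- the support of the summand lies in the range of `g`
  have hsupp : Function.support ((S ∩ {o | ∀ j, o j ≠ none}).indicator ⇑P) ⊆ Set.range g := by
    intro o ho
    rw [Function.mem_support] at ho
    have ho' : o ∈ S ∩ {o | ∀ j, o j ≠ none} := by
      by_contra h; exact ho (Set.indicator_of_notMem h _)
    rw [Set.mem_range]
    exact ⟨fun j => (o j).get (Option.ne_none_iff_isSome.1 (ho'.2 j)), funext fun j => by simp [hg]⟩
  rw [← hginj.tsum_eq hsupp]
  refine tsum_congr fun w => ?_
  by_cases hw : g w ∈ S
  · rw [Set.indicator_of_mem (show g w ∈ S ∩ {o | ∀ j, o j ≠ none} from ⟨hw, fun j => by simp [hg]⟩),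
      Set.indicator_of_mem (show w ∈ {w | (fun j => some (w j)) ∈ S} from hw), hP,
      indepLaw_firstSuccess_apply_comp_some p hq N k w]
  · rw [Set.indicator_of_notMem (show g w ∉ S ∩ {o | ∀ j, o j ≠ none} from fun h => hw h.1),
      Set.indicator_of_notMem (show w ∉ {w | (fun j => some (w j)) ∈ S} from hw), mul_zero]

/-- **Corollary**: `Pr[all N blocks succeed ∧ o ∈ S] ≤ q^{⊗N}({w | (some wⱼ)ⱼ ∈ S})` — with
`toReal_indepLaw_exists_eq_none_le`, `Pr[o ∈ S] ≤ N p(none)^k + q^{⊗N}(…)`. [folklore] -/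
theorem toReal_indepLaw_firstSuccess_le (p : PMF (Option α)) {q : PMF α}
    (hq : ∀ a, p (some a) = (1 - p none) * q a) (N k : ℕ) (S : Set (Fin N → Option α)) :
    ((indepLaw N fun _ => (indepLaw k fun _ => p).map fun v => (List.ofFn v).findSome? id).toOuterMeasure
        S).toReal ≤
      N * (p none ^ k).toReal +
        ((indepLaw N fun _ => q).toOuterMeasure {w | (fun j => some (w j)) ∈ S}).toReal := by
  set P := indepLaw N fun _ => (indepLaw k fun _ => p).map fun v => (List.ofFn v).findSome? id with hP
  have hsplit : S ⊆ {o | ∃ j, o j = none} ∪ (S ∩ {o | ∀ j, o j ≠ none}) := by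
    intro o ho
    by_cases h : ∃ j, o j = none
    · exact Or.inl h
    · exact Or.inr ⟨ho, fun j hj => h ⟨j, hj⟩⟩
  have hne : ∀ T : Set (Fin N → Option α), P.toOuterMeasure T ≠ ∞ := fun T =>
    ne_top_of_le_ne_top ENNReal.one_ne_top ((P.toOuterMeasure_mono (Set.subset_univ _)).trans_eq
      ((P.toOuterMeasure_apply_eq_one_iff _).2 (Set.subset_univ _)))
  calc (P.toOuterMeasure S).toReal
      ≤ (P.toOuterMeasure {o | ∃ j, o j = none} + P.toOuterMeasure (S ∩ {o | ∀ j, o j ≠ none})).toReal :=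
        ENNReal.toReal_mono (ENNReal.add_ne_top.2 ⟨hne _, hne _⟩)
          ((P.toOuterMeasure_mono (Set.inter_subset_left.trans hsplit)).trans
            (measure_union_le _ _))
    _ ≤ N * (p none ^ k).toReal +
        ((indepLaw N fun _ => q).toOuterMeasure {w | (fun j => some (w j)) ∈ S}).toReal := by
        rw [ENNReal.toReal_add (hne _) (hne _)]
        refine add_le_add (toReal_indepLaw_exists_eq_none_le p N k) ?_
        rw [hP, toOuterMeasure_indepLaw_firstSuccess_inter_eq p hq N k S, ENNReal.toReal_mul]
        refine mul_le_of_le_one_left ENNReal.toReal_nonneg ?_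
        refine ENNReal.toReal_le_of_le_ofReal zero_le_one ?_
        rw [ENNReal.ofReal_one]
        exact pow_le_one₀ zero_le tsub_le_self

end Literature.Probability.Distributions

end
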